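import Literature.AlgebraicGeometry.Frobenioids.IsometryWideSubcategory
import Literature.AlgebraicGeometry.Frobenioids.FrTrFrobenioid
import HarnessLib

/-!
# Frobenioids II, Example 3.3 (iii): the wide subcategory of isometries — pre-steps, connectedness

Mochizuki, *The geometry of Frobenioids II: poly-Frobenioids*, Kyushu J. Math. **62** (2008)
401–460, §3, Example 3.3 (iii) p. 29 [cite: MochizukiFrdII2008, Ex 3.3 (iii) p.29] ("a routine
verification reveals that `A` satisfies the conditions of [Mzk5], Definition 1.3").  PROOF-ONLY file
(no definition), generic part continued: for the wide subcategory `𝒲` of isometries of a FROBENIOID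
`C → F_Φ` with the zero-monoid structure (abc-iut-L1-t6's `PreFrobenioid.isometriesToElem`):
the co-angular pre-steps of `𝒲` are exactly the isomorphisms ([FrdI] Def. 1.3 (iii)(d) of `C` at
`Div = 0`); every endomorphism is co-angular; `𝒲` is totally epimorphic; and `𝒲` is connected as soon
as base-isomorphic objects of `C` receive ISOMETRIC pre-steps from a common object (the isometric form
of Def. 1.3 (i)(b), hypothesis `h1` below — the one piece of the verification that is special to the
Frobenioid at hand); hence `𝒲 → F_0` is a pre-Frobenioid.
-/

namespace Literature.AlgebraicGeometry.Frobenioids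

open CategoryTheory Opposite

universe w v v' u u'

namespace PreFrobenioid

namespace Isometries

variable {D : Type u} [Category.{v} D] {Φ : Dᵒᵖ ⥤ CommMonCat.{w}}
  {C : Type u'} [Category.{v'} C] {F : C ⥤ ElemFrobenioid Φ}

/-! ### Co-angular pre-steps of `𝒲` are the isomorphisms -/

/-- A co-angular pre-step of `𝒲` — a co-angular ISOMETRIC pre-step of `C` — is an isomorphism: by
[FrdI] Def. 1.3 (iii)(d) for `C` (fullness of `Div` on co-angular pre-steps under an object, at
`Div(φ) = 0 = Div(id)`) it has a retraction, and `C` is totally epimorphic.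
[cite: MochizukiFrdII2008, Ex 3.3 (iii) p.29] -/
theorem isIso_of_isCoAngularPreStep (hF : IsFrobenioid F) {X Y : WideSubcategory (isometricMorphisms F)}
    (φ : X ⟶ Y) (h : IsCoAngularPreStep (isometriesToElem F) φ) : IsIso φ := by
  have hP := hF.isPreFrobenioid
  have hC : IsCoAngularPreStep F φ.1 := (isCoAngularPreStep_iff hP φ).1 h
  have hid : IsCoAngularPreStep F (𝟙 X.obj) :=
    ⟨isCoAngular_of_isIso F hP.isTotallyEpimorphic _, isPreStep_of_isIso F _⟩
  obtain ⟨f, -, hφf⟩ := hF.iii_d_under_full φ.1 (𝟙 X.obj) hC hid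
    (by rw [show Div F φ.1 = 1 from φ.2, div_id])
  haveI : Epi φ.1 := hP.isTotallyEpimorphic.epi _
  have h2 : f ≫ φ.1 = 𝟙 Y.obj := by
    rw [← cancel_epi φ.1, ← Category.assoc, hφf, Category.id_comp, Category.comp_id]
  haveI : IsIso φ.1 := ⟨⟨f, hφf, h2⟩⟩
  exact isIso_of_isIso_val hP φ

/-- Conversely every isomorphism of `𝒲` is a co-angular pre-step.
[cite: MochizukiFrdII2008, Ex 3.3 (iii) p.29] -/
theorem isCoAngularPreStep_of_isIso (hP : IsPreFrobenioid Φ F)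
    {X Y : WideSubcategory (isometricMorphisms F)} (φ : X ⟶ Y) [IsIso φ] :
    IsCoAngularPreStep (isometriesToElem F) φ := by
  haveI := isIso_val φ
  exact ⟨isCoAngular_of_val hP φ (isCoAngular_of_isIso F hP.isTotallyEpimorphic φ.1),
    isPreStep_of_isIso (isometriesToElem F) φ⟩

/-- Co-angular pre-step of `𝒲` iff isomorphism. [cite: MochizukiFrdII2008, Ex 3.3 (iii) p.29] -/
theorem isCoAngularPreStep_iff_isIso (hF : IsFrobenioid F) {X Y : WideSubcategory (isometricMorphisms F)}
    (φ : X ⟶ Y) : IsCoAngularPreStep (isometriesToElem F) φ ↔ IsIso φ :=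
  ⟨isIso_of_isCoAngularPreStep hF φ, fun _ => isCoAngularPreStep_of_isIso hF.isPreFrobenioid φ⟩

/-- Every endomorphism of `𝒲` is co-angular ([FrdI] Def. 1.3 (iii)(b) for `C` at the identity,
found's `isCoAngular_endo`). [cite: MochizukiFrdII2008, Ex 3.3 (iii) p.29] -/
theorem isCoAngular_endo (hF : IsFrobenioid F) {X : WideSubcategory (isometricMorphisms F)}
    (φ : X ⟶ X) : IsCoAngular (isometriesToElem F) φ :=
  isCoAngular_of_val hF.isPreFrobenioid φ (PreFrobenioid.isCoAngular_endo F hF φ.1)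

/-! ### `𝒲` is totally epimorphic and connected -/

/-- `𝒲` is totally epimorphic (as `C` is). [cite: MochizukiFrdII2008, Ex 3.3 (iii) p.29] -/
theorem isTotallyEpimorphic (hP : IsPreFrobenioid Φ F) :
    IsTotallyEpimorphic (WideSubcategory (isometricMorphisms F)) := by
  refine ⟨fun φ => ⟨fun g h e => ?_⟩⟩
  haveI := hP.isTotallyEpimorphic.epi φ.1
  exact WideSubcategory.hom_ext _ ((cancel_epi φ.1).mp (congrArg (·.hom) e))

/-- Base-isomorphic objects are joined by a zigzag of `𝒲` when base-isomorphic objects of `C`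
receive isometric pre-steps from a common object (`h1`). [cite: MochizukiFrdII2008, Ex 3.3 (iii) p.29] -/
theorem zigzag_of_baseIso
    (h1 : ∀ (A B : C) (α : baseObj F A ≅ baseObj F B), ∃ (X : C) (φ : X ⟶ A) (ψ : X ⟶ B),
      IsIsometricPreStep F φ ∧ IsIsometricPreStep F ψ ∧ Base F φ ≫ α.hom = Base F ψ)
    (A B : WideSubcategory (isometricMorphisms F)) (α : baseObj F A.obj ≅ baseObj F B.obj) :
    Zigzag A B := by
  obtain ⟨X, φ, ψ, hφ, hψ, -⟩ := h1 A.obj B.obj α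
  let X₁ : WideSubcategory (isometricMorphisms F) := ⟨X⟩
  let φ₁ : X₁ ⟶ A := ⟨φ, hφ.1⟩
  let ψ₁ : X₁ ⟶ B := ⟨ψ, hψ.1⟩
  exact (Zigzag.of_inv φ₁).trans (Zigzag.of_hom ψ₁)

/-- An arrow between base objects is covered by a zigzag of `𝒲` (pull back along it, Def. 1.3 (i)(c),
then use `h1`). [cite: MochizukiFrdII2008, Ex 3.3 (iii) p.29] -/
theorem zigzag_of_base_hom (hF : IsFrobenioid F)
    (h1 : ∀ (A B : C) (α : baseObj F A ≅ baseObj F B), ∃ (X : C) (φ : X ⟶ A) (ψ : X ⟶ B),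
      IsIsometricPreStep F φ ∧ IsIsometricPreStep F ψ ∧ Base F φ ≫ α.hom = Base F ψ)
    (A B : WideSubcategory (isometricMorphisms F)) (f : baseObj F A.obj ⟶ baseObj F B.obj) :
    Zigzag A B := by
  obtain ⟨X, ψ, i, -, -⟩ := exists_isPullbackMorphism_over hF B f
  exact (zigzag_of_baseIso h1 A X i.symm).trans (Zigzag.of_hom ψ)

/-- Objects whose base objects are joined by a zigzag of `D` are joined by a zigzag of `𝒲`.
[cite: MochizukiFrdII2008, Ex 3.3 (iii) p.29] -/
theorem zigzag_of_zigzag_base (hF : IsFrobenioid F)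
    (h1 : ∀ (A B : C) (α : baseObj F A ≅ baseObj F B), ∃ (X : C) (φ : X ⟶ A) (ψ : X ⟶ B),
      IsIsometricPreStep F φ ∧ IsIsometricPreStep F ψ ∧ Base F φ ≫ α.hom = Base F ψ)
    {d d' : D} (hz : Zigzag d d') :
    ∀ (A : WideSubcategory (isometricMorphisms F)) (eA : baseObj F A.obj ≅ d)
      (B : WideSubcategory (isometricMorphisms F)) (eB : baseObj F B.obj ≅ d'), Zigzag A B := by
  induction hz with
  | refl => exact fun A eA B eB => zigzag_of_baseIso h1 A B (eA ≪≫ eB.symm)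
  | @tail b c _ hbc ih =>
    intro A eA B eB
    obtain ⟨M, -, ⟨eM⟩⟩ := hF.i_a b
    let M₁ : WideSubcategory (isometricMorphisms F) := ⟨M⟩
    rcases hbc with ⟨⟨g⟩⟩ | ⟨⟨g⟩⟩
    · exact (ih A eA M₁ eM).trans (zigzag_of_base_hom hF h1 M₁ B (eM.hom ≫ g ≫ eB.inv))
    · exact (ih A eA M₁ eM).trans (zigzag_of_base_hom hF h1 B M₁ (eB.hom ≫ g ≫ eM.inv)).symm

/-- `𝒲` is connected (given `h1`). [cite: MochizukiFrdII2008, Ex 3.3 (iii) p.29] -/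
theorem isGraphConnected (hF : IsFrobenioid F)
    (h1 : ∀ (A B : C) (α : baseObj F A ≅ baseObj F B), ∃ (X : C) (φ : X ⟶ A) (ψ : X ⟶ B),
      IsIsometricPreStep F φ ∧ IsIsometricPreStep F ψ ∧ Base F φ ≫ α.hom = Base F ψ) :
    IsGraphConnected (WideSubcategory (isometricMorphisms F)) := by
  obtain ⟨⟨A⟩, hz⟩ := hF.isPreFrobenioid.isGraphConnected
  refine ⟨⟨⟨A⟩⟩, fun X Y => ?_⟩
  exact zigzag_of_zigzag_base hF h1 (hF.isPreFrobenioid.isGraphConnected_base.zigzag _ _)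
    X (Iso.refl _) Y (Iso.refl _)

/-- **`𝒲 → F_0` is a pre-Frobenioid** (for `C → F_Φ` a Frobenioid satisfying `h1`): the zero monoid is
a divisorial monoid on `D`, `𝒲` is connected and totally epimorphic.
[cite: MochizukiFrdII2008, Ex 3.3 (iii) p.29] -/
theorem isPreFrobenioid (hF : IsFrobenioid F)
    (h1 : ∀ (A B : C) (α : baseObj F A ≅ baseObj F B), ∃ (X : C) (φ : X ⟶ A) (ψ : X ⟶ B),
      IsIsometricPreStep F φ ∧ IsIsometricPreStep F ψ ∧ Base F φ ≫ α.hom = Base F ψ) :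
    IsPreFrobenioid (zeroMonoid D : Dᵒᵖ ⥤ CommMonCat.{0}) (isometriesToElem F) where
  isMonoidOn := isMonoidOn_zeroMonoid
  isDivisorial := isDivisorial_zeroMonoid
  isGraphConnected_base := hF.isPreFrobenioid.isGraphConnected_base
  isTotallyEpimorphic_base := hF.isPreFrobenioid.isTotallyEpimorphic_base
  isGraphConnected := isGraphConnected hF h1
  isTotallyEpimorphic := isTotallyEpimorphic hF.isPreFrobenioid

end Isometries

end PreFrobenioid

end Literature.AlgebraicGeometry.Frobenioids
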